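import Mathlib
import HarnessLib
import Summits.HubbardSuperconductivity.HubbardSuperconductivity.Theorems.KLProgrammeKLRegimeEngineV8ExportUnroll2
import Summits.HubbardSuperconductivity.HubbardSuperconductivity.Theorems.KLProgrammeKLRegimeEngineV8IsoTupleExportW
import Summits.HubbardSuperconductivity.HubbardSuperconductivity.Theorems.KLProgrammeKLRegimeEngineV8RaiseDoors
import Summits.HubbardSuperconductivity.HubbardSuperconductivity.Theorems.KLProgrammeKLRegimeEngineScaleZeroKernelNormsWt4Q7

/-!
# Skeleton v2 of `KLRegimeEngineV17F2` (stmt-HubbardSuperconductivity-20437), «∃-UNROLL» with the (R59e)(ii) INTERLEAVE: the CLASS-#6 SUCCESSOR twins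
# (`IsoTupleLineStepW`, …EngineV8IsoTupleExportW p556352 — parameter-Q, (W-a) inputs) (cell gate-hubbard-kl, seat p1b g10 — 20437 registrant lineage)

Companion of `…EngineV8ExportUnroll2` (p553474).  Class #6's successor step `IsoTupleLineStepW P R Q a b u` (k3c2-p2, (R59f) (α)-shape) reads, at scale `n`, the
WEIGHTED quartic data `∀ j ≤ n, KernelNormsWt4 L M (klWtBudget P Q U j) β U μ (K_n) j` — a PUBLIC scale-`n` slot (stub (b)ₙ's own conjunct) — so the class-#6 export
is NOT pre-unrollable from the (X) stub alone: the v2 composition INTERLEAVES, supplying that data at EVERY scale `m ≤ n` (from (b)ₘ for `m ≥ 1`, from the scale-0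
(E1-W) theorem at `m = 0`) and unrolling the iso lines over `exports_all_of_step₂` with the weighted-levels bundle as the first history ((R59e)(ii), dry-run of
record rev 2 `engine-flow-v2x.dryrun-r2.lean` 4eb665f9d5c2704b, (R59k)).  This module supplies:

* §1 **`isoTupleLineAt_all_of_stepW`** — from `IsoTupleLineStepW P R Q a b u`, `G.WF`, the v2 binders (`0 < cc ≤ klEngC₃6`, `μ ∈ klWindowC`, `0 < U ≤ klEngU₀10 P R cc`,
  `U ≤ u cc`, `klBetaMin ≤ β ≤ e^{cc/U²}`, `klEngL₄ P R β U ≤ L`, `klEngM₃ β U L ≤ M`), `h0`, `R.WF2`, the public history up to `n ≤ n_β + 1` at `G P Q R` AND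
  `hwt : ∀ m ≤ n, ∀ j ≤ m, KernelNormsWt4 L M (klWtBudget P Q U j) β U μ (K_m) j`: the iso line at EVERY `j ≤ n`; **`isoTupleLineAt_klE5W_all_of_exists`** — the same from the
  (X).2 conjunct `∃ e, IsIsoPkgW P CF e ∧ IsoTupleLineStepW P R Q e.1 e.2.1 e.2.2` BYTE-VERBATIM, at the deferred constants `klE5aW/klE5bW P R Q CF` below the deferred threshold
  `klE5uW P R Q CF cc`.
* §2 **`kernelNormsWt4_levels_zero_of_isRaiseOf`** — the `m = 0` supplier of `hwt`: at ANY raise `Q` of `klEngQ7 P R` and any admissible frame `K`,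
  `∀ j ≤ 0, KernelNormsWt4 L M (klWtBudget P Q U j) β U μ K j` (`kernelNormsWt4_zero_klWtBudget_klEngQ7U9` ∘ `kernelNormsWt4_klWtBudget_of_isRaiseOf`, k3c2-p1's RaiseDoors),
  under the v2 doors (`U ≤ klEngU₀10`, `klEngL₄ ≤ L`).

Proofs only; no definitions; nothing here asserts that any step Prop holds; nothing asserts superconductivity.
References: BGM 2006 §2.4–§3 [cite: BenfattoGiulianiMastropietro2006].
-/

noncomputable section

namespace Summit.HubbardSuperconductivity.HubbardSuperconductivity.Theorems.EngineV8

set_option linter.dupNamespace false -- summit = problem name (single-conjunct summit), D-0017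

open Real Finset Literature.MathematicalPhysics.QuantumLattice Literature.Probability.LatticeModels
open Literature.MathematicalPhysics.QuantumLattice.FermiRG
open Summit.HubbardSuperconductivity.HubbardSuperconductivity.Theorems.KLProgrammeLegKernels
open Summit.HubbardSuperconductivity.HubbardSuperconductivity.Theorems.DispersionFlow
open Summit.HubbardSuperconductivity.HubbardSuperconductivity.Theorems.KLRegimeSplit

/-! ## §1 Class #6, successor shape (`IsoTupleLineStepW`, parameter-Q, (W-a) inputs) -/

section Unroll3

variable {P : SplitConsts} {R : RenConsts} {Q : EngConsts} {G : GeoConsts} {cc μ U β CF : ℝ} {L M : ℕ} [NeZero L] [NeZero M]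

/-- **CLASS #6 UNROLLED, successor shape with the (R59e)(ii) interleave**: from `IsoTupleLineStepW P R Q a b u`, the binders, the public history up to
`n ≤ n_β + 1` at `G P Q R` and the weighted-levels data `hwt m` at EVERY scale `m ≤ n` (each at its own frame `K_m`): the iso line at every `j ≤ n`. -/
theorem isoTupleLineAt_all_of_stepW {a b : ℝ} {u : ℝ → ℝ} (hstep : IsoTupleLineStepW P R Q a b u) (hG : G.WF)
    (hcc0 : 0 < cc) (hcc : cc ≤ klEngC₃6 P R) (hμ : μ ∈ klWindowC) (h0 : FrameOK R U (nScales β) μ 0) (hU : 0 < U) (hU10 : U ≤ klEngU₀10 P R cc)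
    (hUu : U ≤ u cc) (hβ : klBetaMin ≤ β) (hβc : β ≤ Real.exp (cc / U ^ 2)) (hL : klEngL₄ P R β U ≤ L) (hM : klEngM₃ β U L ≤ M) (hR : R.WF2)
    {n : ℕ} (hn : n ≤ nScales β + 1) (hhist : HistP klPredsV17F2 L M G P Q R β U μ 0 n)
    (hwt : ∀ m ≤ n, ∀ j ≤ m, KernelNormsWt4 L M (klWtBudget P Q U j) β U μ (klFlowFrameU L M β U μ m) j) : ∀ j ≤ n, IsoTupleLineAt L M a b P β U μ j :=
  exports_all_of_step₂ (E := fun m => ∀ j ≤ m, KernelNormsWt4 L M (klWtBudget P Q U j) β U μ (klFlowFrameU L M β U μ m) j)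
    (F := fun j => IsoTupleLineAt L M a b P β U μ j) (N := n) hwt
    (fun m hm hE hist => by
      have hmn : m ≤ nScales β + 1 := hm.trans hn
      have hhm : HistP klPredsV17F2 L M G P Q R β U μ 0 m := histP_klPredsV17F2_of_le hhist hm
      exact hstep G hG cc hcc0 hcc μ hμ U hU hU10 hUu β hβ hβc L M hL hM m hmn (isKLRegime_of_le_nScales_succ hcc0.le hβ hβc hmn) hhm
        (frameOK_klFlowFrameU_of_histP hR h0 hmn hhm) (hE m le_rfl) hist)
    n le_rfl

/-- **CLASS #6 AT THE DEFERRED CONSTANTS, from the existence statement** — the (X).2 conjunct of `stub_engine_exports` byte-verbatim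
(`∃ e, IsIsoPkgW P CF e ∧ IsoTupleLineStepW P R Q e.1 e.2.1 e.2.2`): below the deferred threshold `klE5uW P R Q CF cc`, the iso lines at `(klE5aW, klE5bW) P R Q CF` at every
`j ≤ n`, given the weighted-levels data at every scale `m ≤ n`. -/
theorem isoTupleLineAt_klE5W_all_of_exists (hex : ∃ e : ℝ × ℝ × (ℝ → ℝ), IsIsoPkgW P CF e ∧ IsoTupleLineStepW P R Q e.1 e.2.1 e.2.2) (hG : G.WF)
    (hcc0 : 0 < cc) (hcc : cc ≤ klEngC₃6 P R) (hμ : μ ∈ klWindowC) (h0 : FrameOK R U (nScales β) μ 0) (hU : 0 < U) (hU10 : U ≤ klEngU₀10 P R cc)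
    (hUu : U ≤ klE5uW P R Q CF cc) (hβ : klBetaMin ≤ β) (hβc : β ≤ Real.exp (cc / U ^ 2)) (hL : klEngL₄ P R β U ≤ L) (hM : klEngM₃ β U L ≤ M) (hR : R.WF2)
    {n : ℕ} (hn : n ≤ nScales β + 1) (hhist : HistP klPredsV17F2 L M G P Q R β U μ 0 n)
    (hwt : ∀ m ≤ n, ∀ j ≤ m, KernelNormsWt4 L M (klWtBudget P Q U j) β U μ (klFlowFrameU L M β U μ m) j) :
    ∀ j ≤ n, IsoTupleLineAt L M (klE5aW P R Q CF) (klE5bW P R Q CF) P β U μ j :=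
  isoTupleLineAt_all_of_stepW (isoTupleLineStepW_klE5W_of_exists hex) hG hcc0 hcc hμ h0 hU hU10 hUu hβ hβc hL hM hR hn hhist hwt

end Unroll3

/-! ## §2 The `m = 0` supplier of the (W-a) input along a raise -/

section ScaleZero

variable {P : SplitConsts} {R : RenConsts} {Q : EngConsts} {c μ U β : ℝ} {K : TrigPolyC4v} {L M : ℕ} [NeZero L] [NeZero M]

/-- **The weighted-levels data at scale `0`, at ANY raise `Q` of `klEngQ7 P R` and any admissible frame `K`** (the `m = 0` case of the interleave's `hwt`; the
v2 doors `U ≤ klEngU₀10 P R c`, `klEngL₄ P R β U ≤ L`): `∀ j ≤ 0, KernelNormsWt4 L M (klWtBudget P Q U j) β U μ K j` — the scale-0 (E1-W) theorem at `klEngQ7`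
transported by the budget's monotonicity along the raise. -/
theorem kernelNormsWt4_levels_zero_of_isRaiseOf (hQ : (klEngQ7 P R).IsRaiseOf Q) (hP : P.WF) (hR : R.WF2) (hc : 0 < c) (hc₆ : c ≤ klEngC₃6 P R)
    (hμ : μ ∈ klWindowC) (hU : 0 < U) (hU10 : U ≤ klEngU₀10 P R c) (hβ : klBetaMin ≤ β) (hβc : β ≤ Real.exp (c / U ^ 2)) (hK : FrameOK R U (nScales β) μ K)
    (hL : klEngL₄ P R β U ≤ L) (hM : klEngM₃ β U L ≤ M) : ∀ j ≤ 0, KernelNormsWt4 L M (klWtBudget P Q U j) β U μ K j := by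
  intro j hj
  obtain rfl : j = 0 := Nat.le_zero.mp hj
  exact kernelNormsWt4_klWtBudget_of_isRaiseOf hQ (klEngQ7_wf P R).1 (zero_le_one.trans hP.1)
    (kernelNormsWt4_zero_klWtBudget_klEngQ7U9 P R c hP hR hc hc₆ μ hμ U hU (hU10.trans (klEngU₀10_le_klEngU₀9 P R c)) β hβ hβc K hK L M
      (klEngL₃_le_of_klEngL₄_le hL) hM)

end ScaleZero

end Summit.HubbardSuperconductivity.HubbardSuperconductivity.Theorems.EngineV8

end
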